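import Summits.ABC.ABC.Theses.IsogenyGlueCongruence

/-!
# Sketch (crux-ideate, stmt-ABC-2046 `PolyDegreeOfBoundedPrimes`, round 1, ideator 3)

First-lemma signatures for the idea cards
* `prime-power-torsion-gluing` (depth lever): `EllipticGluingPrimePowerBound` (U^e),
  `DegreePrimePowersPolyBounded` (DepthBound), the provable-now glue `DepthBoundOfGluing`,
  the residual laws `RadicalDegreeBound`, `SmallExcessDepthBound δ`, and the composition
  `LineOfDepthRadicalExcess`.
* `adjoint-irregularity-radical` (multiplicity lever): `RadicalDegreeBound`,
  `PowerfulPartBound`, `radical_implies_degreePrimes` (A is the prime-wise shadow of the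
  radical law), `SplitOfPolyDegree`.
All statements use the ∃D / minimal-datum idiom of the route (`MinimalFor`).
-/

set_option linter.dupNamespace false

namespace Summit.ABC.ABC.Cruxes.PolyDegreeOfBoundedPrimes.SketchIdeator3

open Summit.ABC.ABC.Theses.IsogenyGlueCongruence
open Literature.NumberTheory.EllipticCurves.ModularForms

/-- `D` has minimal degree among the modular parametrisation data of `W` itself at level
`N_W` (exists as soon as one datum exists, by well-ordering of `ℕ`). -/
def MinimalFor (W : WeierstrassCurve ℚ) [W.IsElliptic] [NeZero (W.conductorNorm ℤ)]
    (D : ModularParametrizationData W (W.conductorNorm ℤ)) : Prop :=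
  ∀ D' : ModularParametrizationData W (W.conductorNorm ℤ), D.modularDegree ≤ D'.modularDegree

/-- **U^e — prime-POWER E-multiplier bound** (card `prime-power-torsion-gluing`): the
route's lever `EllipticGluingPrimeBound` with the prime `ℓ` replaced by a prime power `ℓ^k`:
if a non-zero `E`-multiplier of `B` exists and `ℓ^k` divides EVERY multiplier, then
`ℓ^k ≤ C·(dim B · max(1, h_F(W)))^κ` with ABSOLUTE `κ, C`. Known for `dim B ≤ g₀` with the partner's height kept, exactly as for U
(Gaudron–Rémond 2023 Thm 1.5(1), p. 13, bounds the exponent of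
`coker(Hom(A′,B′) → Hom_Gal(A′[m],B′[m]))` uniformly in the modulus `m`); consistent with the
whole twist class `M ⊗ E` (there `ℓ^k ≤ 2·dim B + 2`). -/
def EllipticGluingPrimePowerBound : Prop :=
  ∃ κ C : ℝ, 0 ≤ κ ∧ ∀ (W : WeierstrassCurve ℚ) [W.IsElliptic]
    (E B : Literature.AlgebraicGeometry.Motives.AbelianVariety.{0} ℚ)
    (e : E.geomPoints ≃+ W.geomPoints),
    (∀ (σ : Field.absoluteGaloisGroup ℚ) (P : E.geomPoints), e (σ • P) = σ • e P) →
    ∀ ℓ k : ℕ, ℓ.Prime → 1 ≤ k →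
      (∃ (α : E ⟶ B) (β : B ⟶ E) (n : ℤ), n ≠ 0 ∧
        CategoryTheory.CategoryStruct.comp α β = n • CategoryTheory.CategoryStruct.id E) →
      (∀ (α : E ⟶ B) (β : B ⟶ E) (n : ℤ),
        CategoryTheory.CategoryStruct.comp α β = n • CategoryTheory.CategoryStruct.id E →
          ((ℓ ^ k : ℕ) : ℤ) ∣ n) →
      ((ℓ ^ k : ℕ) : ℝ) ≤ C * ((B.dim : ℝ) * max 1 W.stableFaltingsHeight) ^ κ

/-- **DepthBound** — every prime POWER dividing the modular degree of a semistable curve is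
polynomially bounded: `ℓ^k ∣ deg ⟹ ℓ^k ≤ C·N^κ` (∃D idiom, as crux A). Strictly between
A (`DegreePrimesPolyBounded`, k = 1) and P. -/
def DegreePrimePowersPolyBounded : Prop :=
  ∃ κ C : ℝ, ∀ (W : WeierstrassCurve ℚ) [W.IsElliptic] [W.IsGloballyMinimal]
    [NeZero (W.conductorNorm ℤ)], W.IsSemistable ℤ →
    ∃ D : ModularParametrizationData W (W.conductorNorm ℤ), MinimalFor W D ∧
      ∀ ℓ k : ℕ, ℓ.Prime → ℓ ^ k ∣ D.modularDegree →
        ((ℓ ^ k : ℕ) : ℝ) ≤ C * (W.conductorNorm ℤ : ℝ) ^ κ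

/-- Glue, PROVABLE NOW (same `Real.rpow` bookkeeping as the route's
`DegreePrimesOfGluingBound`): U^e + the modular instance + Pasten's height bound give
DepthBound, because `ℓ^k ∣ D.modularDegree ∣ n` for every `E`-multiplier `n` of `J₀(N)`. -/
def DepthBoundOfGluing : Prop :=
  EllipticGluingPrimePowerBound → ModularJacobianMultipliers → SemistableHeightPolyBound →
    DegreePrimePowersPolyBounded

/-- **RadicalDegreeBound** (card `adjoint-irregularity-radical`): the RADICAL (squarefree
kernel) of the minimal modular degree of a semistable curve is polynomially bounded —
sizes × multiplicity of the congruence primes at once; A is its prime-by-prime shadow. -/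
def RadicalDegreeBound : Prop :=
  ∃ κ C : ℝ, ∀ (W : WeierstrassCurve ℚ) [W.IsElliptic] [W.IsGloballyMinimal]
    [NeZero (W.conductorNorm ℤ)], W.IsSemistable ℤ →
    ∃ D : ModularParametrizationData W (W.conductorNorm ℤ), MinimalFor W D ∧
      ((∏ p ∈ D.modularDegree.primeFactors, p : ℕ) : ℝ) ≤ C * (W.conductorNorm ℤ : ℝ) ^ κ

/-- **SmallExcessDepthBound δ**: the EXCESS depth mass `Σ_{ℓ ≤ N^δ, ℓ ∣ deg} (v_ℓ(deg) − 1)·log ℓ`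
carried by the small primes is `≤ κ log N + C` (heuristically bounded: `Σ_ℓ log ℓ / ℓ² < ∞`). -/
def SmallExcessDepthBound (δ : ℝ) : Prop :=
  ∃ κ C : ℝ, ∀ (W : WeierstrassCurve ℚ) [W.IsElliptic] [W.IsGloballyMinimal]
    [NeZero (W.conductorNorm ℤ)], W.IsSemistable ℤ →
    ∃ D : ModularParametrizationData W (W.conductorNorm ℤ), MinimalFor W D ∧
      (∑ p ∈ (D.modularDegree.primeFactors.filter
          (fun q : ℕ => (q : ℝ) ≤ (W.conductorNorm ℤ : ℝ) ^ δ)),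
        ((D.modularDegree.factorization p - 1 : ℕ) : ℝ) * Real.log (p : ℝ)) ≤
        κ * Real.log (W.conductorNorm ℤ : ℝ) + C

/-- The line of card `prime-power-torsion-gluing`: DepthBound ∧ RadicalDegreeBound ∧
SmallExcessDepthBound δ (one δ > 0) ⟹ crux B. Elementary: `log deg = log rad + Σ_{ℓ ≤ N^δ}
(v−1) log ℓ + Σ_{ℓ > N^δ, v ≥ 2} (v−1) log ℓ`, the last sum having ≤ (κ₁ log N + c₁)/(δ log N)
terms each ≤ θ log N + c by DepthBound. (A, the hypothesis of B, is not needed: it is implied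
by RadicalDegreeBound, `radical_implies_degreePrimes`.) -/
def LineOfDepthRadicalExcess : Prop :=
  ∀ δ : ℝ, 0 < δ → DegreePrimePowersPolyBounded → RadicalDegreeBound →
    SmallExcessDepthBound δ → PolyDegreeOfBoundedPrimes

/-- **PowerfulPartBound**: the minimal modular degree is polynomially dominated by its
radical, `deg ≤ C·N^κ·rad(deg)^κ'` — the DEPTH half of P in the radical split. -/
def PowerfulPartBound : Prop :=
  ∃ κ κ' C : ℝ, ∀ (W : WeierstrassCurve ℚ) [W.IsElliptic] [W.IsGloballyMinimal]
    [NeZero (W.conductorNorm ℤ)], W.IsSemistable ℤ →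
    ∃ D : ModularParametrizationData W (W.conductorNorm ℤ), MinimalFor W D ∧
      (D.modularDegree : ℝ) ≤ C * (W.conductorNorm ℤ : ℝ) ^ κ *
        ((∏ p ∈ D.modularDegree.primeFactors, p : ℕ) : ℝ) ^ κ'

/-- The radical split of the consequent of B (card `adjoint-irregularity-radical`):
RadicalDegreeBound ∧ PowerfulPartBound ⟹ B (and conversely P gives both with κ' = 0). -/
def SplitOfPolyDegree : Prop :=
  RadicalDegreeBound → PowerfulPartBound → PolyDegreeOfBoundedPrimes

/-- A is the prime-wise shadow of the radical law: a prime factor of `deg` divides, hence is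
at most, `rad(deg)`. (Provable now; stated as a Prop here.) -/
def radical_implies_degreePrimes : Prop := RadicalDegreeBound → DegreePrimesPolyBounded

end Summit.ABC.ABC.Cruxes.PolyDegreeOfBoundedPrimes.SketchIdeator3
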